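import Literature.Barriers.CriticalPhenomena.GaussianDominationRouteNoble
import Literature.Barriers.CriticalPhenomena.GaussianDominationRouteImprovement
import HarnessLib

/-!
# `FitznerVanDerHofstad2017_prop24` one level down: the improvement of `f₁` and `f₂` in the NoBLE
# analysis ([FitHof13b] Lemmas 3.1, 3.2, 3.4 — PROVED) and the reduction of Prop. 2.4 to the
# simplified NoBLE form with its bounds, the `f₃`-analysis and the numerical conditions

Sibling of `GaussianDominationRouteNoble.lean` (barrier catalogue
`Literature/Barriers/CriticalPhenomena/`). There the computer-assisted core of the percolation
infrared bound in `d ≥ 11` was isolated as the named fact `FitznerVanDerHofstad2017_prop24`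
(Fitzner–van der Hofstad 2017, Prop. 2.4 with its initialisation: constants `γ_i < Γ_i`,
`f_i(p_I) ≤ γ_i`, and `f_i(p) ≤ Γ_i ∀i ⟹ f_i(p) ≤ γ_i ∀i` on `(p_I, p_c)`). Its printed proof is
the model-independent NoBLE analysis of Fitzner–van der Hofstad [FitHof13b] fed with the
percolation NoBLE (FvdH 2017 Prop. 2.1), the diagrammatic bounds (Prop. 2.2, Assumption 5.7) and
three Mathematica notebooks. [FitHof13b] runs on the **simplified NoBLE form** of its §1.3,
`Ĝ_z(k) = Φ̂_z(k)/(1 - F̂_z(k))` with `Φ̂_z = c_Φ + α_Φ D̂ + R̂_Φ`, `F̂_z = c_F + α_F D̂ + R̂_F`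
(derived from the NoBLE equation in its §4), under Assumption 2.7 (bounds `μ̄_z/μ_z ≤ β_μ̄`,
`c_Φ ≤ β̄_c`, `|α_Φ| ≤ β_α`, `α_F ≥ β_F`, `Σ_{x,κ} Π^{ι,κ} ≤ β̄_Π`, `Σ_x Ψ^κ ≥ -β_Ψ`, `Σ|R_Φ| ≤ β_{R,Φ}`,
`R̂_F(0) - R̂_F(k) ≥ -β_Δ [1 - D̂(k)]`, valid when `f_i(z) ≤ Γ_i`), and proves Prop. 2.11 "one
function `f_i` at a time" (§3): Lemma 3.1 (link between NBW and general susceptibility: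
`μ_z = (1+π_z)λ_z/(1+ψ_z(1+λ_z))`, `1 - F̂_z(0) = B̂_{λ_z}(0)⁻¹ = (1-(2d-1)λ_z)/(1+λ_z)`), Lemma 3.2
(`f₁(z) ≤ max{β_μ̄, c_μ}(1+β̄_Π)/(1 - (2d/(2d-1))β_Ψ)`), Lemma 3.4
(`f₂(z) ≤ ((2d-1)/(2d-2))(β̄_c + β_α + β_{R,Φ})/(β_F - β_Δ)`), Lemma 3.5 (continuity of `f₃`, the
tree's named fact `FitznerVanDerHofstad2016NoBLE_lemma35`) and §3.3–§3.3.5 (the `f₃`-improvement,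
through the simple-random-walk integrals of §5); the numerical conditions are Def. 2.9, `P(γ,Γ,z)`.

## What is formalised (namespace `Literature.Barriers.CriticalPhenomena`)

* PROVED, for ARBITRARY data: the `k = 0` algebra of Lemma 3.1 (`noble_sum_vector_identity` — the
  eigenvector computation "the sum of each column … equals `1 + μ_z + π^ι`" —, `noble_link_k0`,
  `noble_link_lambda`, `noble_lambda_lt`), **Lemma 3.2** (`nobleF1_le_of_link`) and **Lemma 3.4**
  (`nobleF2_le_of_simplifiedForm`) over the tree's `nobleF1`, `nobleF2`, `tauHat`, `Dhat`, `cosFT`;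
* the hypothesis structure `NobleBeta` (the eight constants of Assumption 2.7 that Lemmas 3.2, 3.4
  consume), `NobleBeta.Admissible`, the right-hand sides `NobleBeta.f1Bound`, `NobleBeta.f2Bound` of
  the conditions on `γ₁`, `γ₂` in Def. 2.9, and the predicate `NobleSimplifiedFormAt d p B` (the
  simplified form at `p` with the Lemma 3.1 data and the Assumption 2.7 (a)–(c) bounds);
* NAMED FACT `FitznerVanDerHofstad2017_nobleAnalysisInputs` — what parts (a), (b), (d) of the proof
  and [FitHof13b] §3.3, §4 deliver for percolation in `d ≥ 11` — and the PROVED assembly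
  `FitznerVanDerHofstad2017_prop24_of_nobleAnalysisInputs`.

After this file the trust base of `FitznerVanDerHofstad2017_prop24` (hence of
`FitznerVanDerHofstad2017_nobleBound`, with `FitznerVanDerHofstad2016NoBLE_lemma35`) is the NoBLE
derivation and its rewrite (FvdH 2017 Prop. 2.1; [FitHof13b] §4), the diagrammatic bounds
(Prop. 2.2 / Assumption 5.7), the `f₃`-analysis ([FitHof13b] §3.3, §5) and the notebooks — NOT
formalised (a theory of their own: the NoBLE coefficients are not even defined in the tree).

## References

* R. Fitzner, R. van der Hofstad, *Generalized approach to the non-backtracking lace expansion*,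
  Probab. Theory Relat. Fields 169 (2017) 1041–1119 (arXiv:1506.07969, [FitHof13b]): §1.3 (the
  NoBLE form `Ĝ = Φ̂/(1-F̂)` and its simplified rewrite), §2.2 (Assumptions 2.6–2.7 and the line
  after 2.7), Def. 2.9, Prop. 2.11, §3.1 (Lemmas 3.1, 3.2 and their proofs), §3.2 (Lemma 3.4 and its
  proof), §3.3.3, §3.3.5 ("Final bound on `f₃`"), §4.1, Prop. 4.5, §5, §6.
* R. Fitzner, R. van der Hofstad, *Mean-field behavior for nearest-neighbor percolation in `d > 10`*,
  Electron. J. Probab. 22 (2017) no. 43 (arXiv:1506.07977): Prop. 2.1, Prop. 2.2, §2.3 (the NoBLE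
  equation), §2.4 (bootstrap functions, claims (i)–(iii), `μ̄_p = p`), Prop. 2.4, §2.5, §2.6,
  Assumption 5.7, §5.4.
-/

noncomputable section

namespace Literature.Barriers.CriticalPhenomena

open MeasureTheory Filter Topology Literature.Probability.LatticeModels Literature.Probability.Percolation
open scoped BigOperators

variable {d : ℕ}

/-! ### Lemma 3.1: the NoBLE equation at `k = 0` -/

/-- **The eigenvector computation in the proof of [FitHof13b] Lemma 3.1.** At `k = 0` the vector
NoBLE identity of §1.3 reads `Ĝ(0) = Ĝ^ι(0) + μ Ĝ^{-ι}(0) + Σ_κ Π̂^{ι,κ}(0) Ĝ^κ(0) + Ξ̂^ι(0)` for every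
direction `ι`; if every column of `Π̂(0)` sums to `π` (Assumption 2.6; "the sum of each column and
the sum of each row of `I + μ_z J + Π̂_z(0)` equals `1 + μ_z + π^ι`"), then summing over the `2d`
directions gives `2d Ĝ(0) = (1 + μ + π) Σ_ι Ĝ^ι(0) + Σ_ι Ξ̂^ι(0)`. Stated for any finite index type,
the reversal `ι ↦ -ι` being an arbitrary permutation.
[cite: FitznerVanDerHofstad2016NoBLE, Lemma 3.1 (proof) and §1.3 (vector form of the NoBLE)] -/
theorem noble_sum_vector_identity {ι : Type*} [Fintype ι] (rev : ι ≃ ι) {G μ π : ℝ}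
    {Gv Ξv : ι → ℝ} {Pm : ι → ι → ℝ} (hcol : ∀ κ, ∑ i, Pm i κ = π)
    (hvec : ∀ i, G = Gv i + μ * Gv (rev i) + ∑ κ, Pm i κ * Gv κ + Ξv i) :
    (Fintype.card ι : ℝ) * G = (1 + μ + π) * ∑ i, Gv i + ∑ i, Ξv i := by
  have hsum : ∑ i, G = ∑ i, (Gv i + μ * Gv (rev i) + ∑ κ, Pm i κ * Gv κ + Ξv i) :=
    Finset.sum_congr rfl fun i _ => hvec i
  rw [Finset.sum_const, Finset.card_univ, nsmul_eq_mul] at hsum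
  have hrev : ∑ i, Gv (rev i) = ∑ i, Gv i := Equiv.sum_comp rev Gv
  have hPm : ∑ i, ∑ κ, Pm i κ * Gv κ = π * ∑ κ, Gv κ := by
    rw [Finset.sum_comm, Finset.mul_sum]
    refine Finset.sum_congr rfl fun κ _ => ?_
    rw [← Finset.sum_mul, hcol κ]
  rw [hsum, Finset.sum_add_distrib, Finset.sum_add_distrib, Finset.sum_add_distrib, ← Finset.mul_sum,
    hrev, hPm]
  ring

/-- **[FitHof13b] Lemma 3.1 at `k = 0`, first half** ("`Ĝ_z(0) = Φ̂_z(0)/(1 - μ_z(1+ψ_z) 2d/(1+μ_z+π^ι_z))`"):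
from the scalar NoBLE identity at `k = 0`, `G = 1 + Ξ̂(0) + μ(1+ψ) S` (`S = Σ_ι Ĝ^ι(0)`,
`Ψ̂^ι(0) = ψ` for all `ι`), and the summed vector identity `n G = (1+μ+π) S + Σ_ι Ξ̂^ι(0)`
(`noble_sum_vector_identity`, `n = 2d`): cleared of denominators,
`G [(1+μ+π) - nμ(1+ψ)] = (1 + Ξ̂(0))(1+μ+π) - μ(1+ψ) Σ_ι Ξ̂^ι(0)`, i.e. `Ĝ(0)(1 - F̂(0)) = Φ̂(0)` with
`F̂(0) = nμ(1+ψ)/(1+μ+π)`, `Φ̂(0) = 1 + Ξ̂(0) - μ(1+ψ) Σ_ι Ξ̂^ι(0)/(1+μ+π)` (the `Φ̂`, `F̂` of §1.3 at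
`k = 0`). [cite: FitznerVanDerHofstad2016NoBLE, Lemma 3.1 (proof) and §1.3 (definitions of Φ̂_z, F̂_z)] -/
theorem noble_link_k0 {n G μ ψ π S Ξ0 Ξs : ℝ} (h1 : G = 1 + Ξ0 + μ * (1 + ψ) * S)
    (h2 : n * G = (1 + μ + π) * S + Ξs) :
    G * ((1 + μ + π) - n * μ * (1 + ψ)) = (1 + Ξ0) * (1 + μ + π) - μ * (1 + ψ) * Ξs := by
  linear_combination (1 + μ + π) * h1 - μ * (1 + ψ) * h2

/-- **[FitHof13b] Lemma 3.1, the choice of `λ_z`**: if `λ(1 + π - μψ) = μ(1+ψ)` (the lemma's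
`λ_z = (1+ψ_z)μ_z/(1+π^ι_z - μ_zψ_z)`), then (i) `μ(1 + ψ(1+λ)) = (1+π)λ` ("so that
`μ_z = (1+π_z)/((1+ψ_z)/λ_z + ψ_z)`") and (ii) `nμ(1+ψ)(1+λ) = nλ(1+μ+π)`, i.e.
`F̂_z(0) = nμ(1+ψ)/(1+μ+π) = nλ/(1+λ) = 1 - B̂_λ(0)⁻¹` with `B̂_λ(0) = 1/(1 - nλ/(1+λ))`, `n = 2d`
("`B̂_{λ_z}(0) Φ̂_z(0) = Ĝ_z(0)`"). [cite: FitznerVanDerHofstad2016NoBLE, Lemma 3.1 (statement and proof)] -/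
theorem noble_link_lambda {n μ ψ π lam : ℝ} (h : lam * (1 + π - μ * ψ) = μ * (1 + ψ)) :
    μ * (1 + ψ * (1 + lam)) = (1 + π) * lam ∧
      n * μ * (1 + ψ) * (1 + lam) = n * lam * (1 + μ + π) := by
  constructor
  · linear_combination (-1 : ℝ) * h
  · linear_combination (-n) * h

/-- If `0 ≤ λ`, `0 < Φ̂(0)`, `0 < Ĝ(0)` and `Ĝ(0)(1 - nλ/(1+λ)) = Φ̂(0)` (`B̂_λ(0)Φ̂(0) = Ĝ(0)`), then
`(n-1)λ < 1` — the remark "`λ_z < (2d-1)⁻¹` if `z < z_c` as `Ĝ_z(0) = B̂_{λ_z}(0)Φ̂_z(0) < ∞`" in the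
proof of [FitHof13b] Lemma 3.2, in the finite form in which it is used.
[cite: FitznerVanDerHofstad2016NoBLE, Lemma 3.2 (proof)] -/
theorem noble_lambda_lt {n G Φ0 lam : ℝ} (hlam : 0 ≤ lam) (hΦ : 0 < Φ0) (hG : 0 < G)
    (h : G * (1 - n * lam / (1 + lam)) = Φ0) : (n - 1) * lam < 1 := by
  have h1 : 0 < 1 + lam := by linarith
  have hpos : 0 < 1 - n * lam / (1 + lam) := by
    rcases lt_or_ge 0 (1 - n * lam / (1 + lam)) with hlt | hle
    · exact hlt
    · have : G * (1 - n * lam / (1 + lam)) ≤ 0 := mul_nonpos_of_nonneg_of_nonpos hG.le hle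
      linarith
  rw [sub_pos, div_lt_one h1] at hpos
  linarith

/-! ### Lemma 3.2: improvement of `f₁` -/

/-- **[FitHof13b] Lemma 3.2 (Improvement of `f₁`), for percolation's
`f₁ = max{(2d-1)μ̄_p, c_μ(2d-1)μ_p}`, `μ̄_p = p`, `μ_p = nobleMu d p`** — the computation in its
proof: if `μ_p = (1+π)λ/(1+ψ(1+λ))` with `0 ≤ λ`, `(2d-1)λ < 1` (Lemma 3.1 and "`λ_z < (2d-1)⁻¹`"),
`π ≤ β̄_Π`, `ψ ≥ -β_Ψ` (Assumption 2.7(b): `π^ι_z = Σ_{x,κ} Π^{ι,κ}_z(x)`, `ψ_z = Σ_x Ψ^κ_z(x)`) and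
`μ̄_p ≤ β_μ̄ μ_p` (Assumption 2.7(a)), then
`(2d-1)μ_p ≤ (1+β̄_Π)(2d-1)λ/(1 - β_Ψ(1+λ)) ≤ (1+β̄_Π)/(1 - (2d/(2d-1))β_Ψ)` and hence
`f₁(p) ≤ max{β_μ̄, c_μ} (1+β̄_Π)/(1 - (2d/(2d-1))β_Ψ)` (the right-hand side of the condition on `γ₁` in
Def. 2.9). The positivity `1 - (2d/(2d-1))β_Ψ > 0`, implicit in the printed display, is a hypothesis.
[cite: FitznerVanDerHofstad2016NoBLE, Lemma 3.2 (proof) and Assumption 2.7 (a)–(b)] -/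
theorem nobleF1_le_of_link (hd : 1 ≤ d) {p : unitInterval} {cμ βμ βPi βΨ ψ π lam : ℝ}
    (hμ : nobleMu d p = (1 + π) * lam / (1 + ψ * (1 + lam)))
    (hlam0 : 0 ≤ lam) (hlam1 : (2 * d - 1) * lam < 1)
    (hπ : π ≤ βPi) (hψ : -βΨ ≤ ψ) (hratio : (p : ℝ) ≤ βμ * nobleMu d p)
    (hcμ : 0 ≤ cμ) (hβμ : 0 ≤ βμ) (hβPi : 0 ≤ βPi) (hβΨ : 0 ≤ βΨ)
    (hden : 2 * d * βΨ / (2 * d - 1) < 1) :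
    nobleF1 d cμ p ≤ max βμ cμ * ((1 + βPi) / (1 - 2 * d * βΨ / (2 * d - 1))) := by
  set Q : ℝ := (1 + βPi) / (1 - 2 * d * βΨ / (2 * d - 1)) with hQ
  have hd' : (1 : ℝ) ≤ d := by exact_mod_cast hd
  have h2d1 : (0 : ℝ) < 2 * d - 1 := by linarith
  -- `1 + λ ≤ 2d/(2d-1)`
  have h1lam : 1 + lam ≤ 2 * d / (2 * d - 1) := by
    rw [le_div_iff₀ h2d1]; nlinarith
  have hdenQ : 0 < 1 - 2 * d * βΨ / (2 * d - 1) := by linarith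
  -- the denominator `1 + ψ(1+λ) ≥ 1 - β_Ψ(1+λ) ≥ 1 - (2d/(2d-1)) β_Ψ > 0`
  have hden1 : 1 - 2 * d * βΨ / (2 * d - 1) ≤ 1 + ψ * (1 + lam) := by
    have h1 : -βΨ * (1 + lam) ≤ ψ * (1 + lam) := mul_le_mul_of_nonneg_right hψ (by linarith)
    have h2 : βΨ * (1 + lam) ≤ βΨ * (2 * d / (2 * d - 1)) := mul_le_mul_of_nonneg_left h1lam hβΨ
    have h3 : βΨ * (2 * d / (2 * d - 1)) = 2 * d * βΨ / (2 * d - 1) := by ring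
    linarith
  have hQ0 : 0 ≤ Q := div_nonneg (by linarith) hdenQ.le
  -- the numerator `(1+π)(2d-1)λ ≤ 1 + β̄_Π`
  have hnum : (2 * d - 1) * ((1 + π) * lam) ≤ 1 + βPi := by
    rcases le_or_gt 0 (1 + π) with h | h
    · calc (2 * d - 1) * ((1 + π) * lam) = (1 + π) * ((2 * d - 1) * lam) := by ring
        _ ≤ (1 + βPi) * 1 := mul_le_mul (by linarith) hlam1.le (by positivity) (by linarith)
        _ = 1 + βPi := mul_one _
    · have : (1 + π) * lam ≤ 0 := mul_nonpos_of_nonpos_of_nonneg h.le hlam0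
      nlinarith
  -- `(2d-1) μ_p ≤ Q`
  have hkey : (2 * d - 1) * nobleMu d p ≤ Q := by
    rw [hμ, ← mul_div_assoc, hQ]
    exact div_le_div₀ (by linarith) hnum hdenQ hden1
  -- the two branches of the maximum
  refine max_le ?_ ?_
  · calc (2 * d - 1) * (p : ℝ) ≤ (2 * d - 1) * (βμ * nobleMu d p) :=
          mul_le_mul_of_nonneg_left hratio h2d1.le
      _ = βμ * ((2 * d - 1) * nobleMu d p) := by ring
      _ ≤ βμ * Q := mul_le_mul_of_nonneg_left hkey hβμ
      _ ≤ max βμ cμ * Q := mul_le_mul_of_nonneg_right (le_max_left _ _) hQ0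
  · calc cμ * (2 * d - 1) * nobleMu d p = cμ * ((2 * d - 1) * nobleMu d p) := by ring
      _ ≤ cμ * Q := mul_le_mul_of_nonneg_left hkey hcμ
      _ ≤ max βμ cμ * Q := mul_le_mul_of_nonneg_right (le_max_right _ _) hQ0

/-! ### Lemma 3.4: improvement of `f₂` -/

/-- **[FitHof13b] Lemma 3.4 (Improvement of `f₂`), for percolation's
`f₂ = ((2d-1)/(2d-2)) sup_k [1 - D̂(k)] |τ̂_p(k)|`** — the computation in its proof: suppose the
simplified NoBLE form of §1.3 holds at `p` on the Brillouin zone, `τ̂_p(k)(1 - F̂(k)) = Φ̂(k)`,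
`F̂ = c_F + α_F D̂ + R̂_F`, `Φ̂ = c_Φ + α_Φ D̂ + R̂_Φ` (`R̂ = cosFT R`), with `1 - F̂(0) = B̂_λ(0)⁻¹`, i.e.
`F̂(0) = 2dλ/(1+λ)`, `0 ≤ λ`, `(2d-1)λ < 1` (Lemma 3.1; whence "`1 - F̂_z(0) = B̂⁻¹_{λ_z}(0) ≥ 0`"), and
the Assumption 2.7 bounds `0 ≤ c_Φ ≤ β̄_c`, `|α_Φ| ≤ β_α`, `Σ|R_Φ| ≤ β_{R,Φ}`, `α_F ≥ β_F`,
`R̂_F(0) - R̂_F(k) ≥ -β_Δ[1 - D̂(k)]`, `β_F - β_Δ > 0`. Then `|Φ̂(k)| ≤ β̄_c + β_α + β_{R,Φ}`,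
`1 - F̂(k) = [1 - F̂(0)] + α_F[1 - D̂(k)] + R̂_F(0) - R̂_F(k) ≥ (β_F - β_Δ)[1 - D̂(k)]`, so
`|τ̂_p(k)|[1 - D̂(k)] ≤ (β̄_c + β_α + β_{R,Φ})/(β_F - β_Δ)` and
`f₂(p) ≤ ((2d-1)/(2d-2)) (β̄_c + β_α + β_{R,Φ})/(β_F - β_Δ)` (the right-hand side of the condition on `γ₂`
in Def. 2.9), `d ≥ 2`. [cite: FitznerVanDerHofstad2016NoBLE, Lemma 3.4 (proof) and Assumption 2.7 (a), (c)] -/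
theorem nobleF2_le_of_simplifiedForm (hd : 2 ≤ d) {p : unitInterval}
    {cΦ αΦ cF αF lam cΦup βαΦ βRΦ αFlow βΔ : ℝ} {RΦ RF : Site d → ℝ} (hRΦ : Summable RΦ)
    (hform : ∀ k ∈ cube d, tauHat d p k * (1 - (cF + αF * Dhat d k + cosFT RF k)) =
      cΦ + αΦ * Dhat d k + cosFT RΦ k)
    (hF0 : cF + αF + cosFT RF 0 = 2 * d * lam / (1 + lam)) (hlam0 : 0 ≤ lam)
    (hlam1 : (2 * d - 1) * lam < 1)
    (hcΦ0 : 0 ≤ cΦ) (hcΦ : cΦ ≤ cΦup) (hαΦ : |αΦ| ≤ βαΦ) (hRΦle : ∑' x, |RΦ x| ≤ βRΦ)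
    (hαF : αFlow ≤ αF) (hRF : ∀ k ∈ cube d, -(βΔ * (1 - Dhat d k)) ≤ cosFT RF 0 - cosFT RF k)
    (hgap : βΔ < αFlow) :
    nobleF2 d p ≤ (2 * d - 1) / (2 * d - 2) * ((cΦup + βαΦ + βRΦ) / (αFlow - βΔ)) := by
  have hd' : (2 : ℝ) ≤ d := by exact_mod_cast hd
  -- `1 - F̂(0) = (1 - (2d-1)λ)/(1+λ) > 0`
  have h1lam : 0 < 1 + lam := by linarith
  have h1F0 : 0 < 1 - (cF + αF + cosFT RF 0) := by
    rw [hF0, sub_pos, div_lt_one h1lam]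
    nlinarith
  set Q : ℝ := (cΦup + βαΦ + βRΦ) / (αFlow - βΔ) with hQ
  have hgap' : 0 < αFlow - βΔ := sub_pos.2 hgap
  -- the pointwise bound on the Brillouin zone
  have hpt : ∀ k : cube d, (1 - Dhat d k.1) * |tauHat d p k.1| ≤ Q := by
    intro k
    have hk : k.1 ∈ cube d := k.2
    have hD0 : 0 ≤ 1 - Dhat d k.1 := one_sub_Dhat_nonneg k.1
    have hden_eq : 1 - (cF + αF * Dhat d k.1 + cosFT RF k.1) =
        (1 - (cF + αF + cosFT RF 0)) + αF * (1 - Dhat d k.1) + (cosFT RF 0 - cosFT RF k.1) := by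
      ring
    -- the lower bound on `1 - F̂(k)`, keeping the positive term `1 - F̂(0)`
    have hden_ge' : (1 - (cF + αF + cosFT RF 0)) + (αFlow - βΔ) * (1 - Dhat d k.1) ≤
        1 - (cF + αF * Dhat d k.1 + cosFT RF k.1) := by
      rw [hden_eq]
      have h1 := hRF k.1 hk
      have h2 : αFlow * (1 - Dhat d k.1) ≤ αF * (1 - Dhat d k.1) :=
        mul_le_mul_of_nonneg_right hαF hD0
      linarith
    have hden_ge : (αFlow - βΔ) * (1 - Dhat d k.1) ≤ 1 - (cF + αF * Dhat d k.1 + cosFT RF k.1) := by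
      linarith
    have hden_pos : 0 < 1 - (cF + αF * Dhat d k.1 + cosFT RF k.1) := by
      have : 0 ≤ (αFlow - βΔ) * (1 - Dhat d k.1) := mul_nonneg hgap'.le hD0
      linarith
    -- the upper bound on `|Φ̂(k)|`
    have hΦ : |cΦ + αΦ * Dhat d k.1 + cosFT RΦ k.1| ≤ cΦup + βαΦ + βRΦ := by
      calc |cΦ + αΦ * Dhat d k.1 + cosFT RΦ k.1|
          ≤ |cΦ| + |αΦ * Dhat d k.1| + |cosFT RΦ k.1| := abs_add_three _ _ _
        _ ≤ cΦup + βαΦ + βRΦ := by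
          refine add_le_add_three ?_ ?_ ((abs_cosFT_le hRΦ k.1).trans hRΦle)
          · rwa [abs_of_nonneg hcΦ0]
          · rw [abs_mul]
            calc |αΦ| * |Dhat d k.1| ≤ βαΦ * 1 :=
                  mul_le_mul hαΦ (abs_Dhat_le_one k.1) (abs_nonneg _) ((abs_nonneg _).trans hαΦ)
              _ = βαΦ := mul_one _
    have hT : |tauHat d p k.1| * (1 - (cF + αF * Dhat d k.1 + cosFT RF k.1)) =
        |cΦ + αΦ * Dhat d k.1 + cosFT RΦ k.1| := by
      rw [← hform k.1 hk, abs_mul, abs_of_pos hden_pos]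
    rw [hQ, le_div_iff₀ hgap']
    calc (1 - Dhat d k.1) * |tauHat d p k.1| * (αFlow - βΔ)
        = |tauHat d p k.1| * ((αFlow - βΔ) * (1 - Dhat d k.1)) := by ring
      _ ≤ |tauHat d p k.1| * (1 - (cF + αF * Dhat d k.1 + cosFT RF k.1)) :=
          mul_le_mul_of_nonneg_left hden_ge (abs_nonneg _)
      _ = |cΦ + αΦ * Dhat d k.1 + cosFT RΦ k.1| := hT
      _ ≤ cΦup + βαΦ + βRΦ := hΦ
  have hsup : nobleSup2 d p ≤ Q := ciSup_le hpt
  have hfac : (0 : ℝ) ≤ (2 * d - 1) / (2 * d - 2) := div_nonneg (by linarith) (by linarith)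
  exact mul_le_mul_of_nonneg_left hsup hfac

/-! ### The inputs of the NoBLE analysis for percolation, and the assembly of Prop. 2.4 -/

/-- The eight constants of [FitHof13b] Assumption 2.7 consumed by Lemmas 3.2 and 3.4 ("with `β_•`
depending only on `Γ₁,Γ₂,Γ₃`, `d` and the model"): `βμ = β_μ̄` (`μ̄_z/μ_z ≤ β_μ̄`), `βPi = β̄_Π`
(`Σ_{x,κ} Π^{ι,κ}_z(x) ≤ β̄_Π`), `βΨ = β_Ψ` (`Σ_x Ψ^κ_z(x) ≥ -β_Ψ`), `cΦup = β̄_c` (`c_Φ ≤ β̄_c`),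
`βαΦ = β_α` (`|α_Φ| ≤ β_α`), `βRΦ = β_{R,Φ}` (`Σ|R_Φ| ≤ β_{R,Φ}`), `αFlow = β_F` (`α_F ≥ β_F`),
`βΔ = β_{ΔR_F}` (`R̂_F(0) - R̂_F(k) ≥ -β_{ΔR_F}[1 - D̂(k)]`). Their numerical values for percolation
live in the Mathematica notebooks of Fitzner–van der Hofstad 2017, §2.5.
[cite: FitznerVanDerHofstad2016NoBLE, Assumption 2.7 (a)–(c)] -/
structure NobleBeta where
  /-- `β_μ̄`: `μ̄_z/μ_z ≤ β_μ̄`. -/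
  βμ : ℝ
  /-- `β̄_Π`: `Σ_{x,κ} Π^{ι,κ}_z(x) ≤ β̄_Π`. -/
  βPi : ℝ
  /-- `β_Ψ`: `Σ_x Ψ^κ_z(x) ≥ -β_Ψ`. -/
  βΨ : ℝ
  /-- `β̄_c`: `c_{Φ,z} ≤ β̄_c`. -/
  cΦup : ℝ
  /-- `β_α`: `|α_{Φ,z}| ≤ β_α`. -/
  βαΦ : ℝ
  /-- `β_{R,Φ}`: `Σ_x |R_{Φ,z}(x)| ≤ β_{R,Φ}`. -/
  βRΦ : ℝ
  /-- `β_F`: `α_{F,z} ≥ β_F`. -/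
  αFlow : ℝ
  /-- `β_{ΔR_F}`: `R̂_{F,z}(0) - R̂_{F,z}(k) ≥ -β_{ΔR_F}[1 - D̂(k)]`. -/
  βΔ : ℝ

/-- Admissibility of the constants: `β_μ̄ > 1` (here `≥ 1`), `β̄_Π, β_Ψ > 0` (here `≥ 0`), the
positivity `1 - (2d/(2d-1))β_Ψ > 0` of the denominator in the condition on `γ₁` (implicit in the
proof of Lemma 3.2), and `β_F - β_{ΔR_F} > 0` ("Further, we assume that `α_F - β_{ΔR_F} > 0`", the
line after Assumption 2.7). [cite: FitznerVanDerHofstad2016NoBLE, Assumption 2.7 and the line following it; Lemma 3.2 (proof)] -/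
def NobleBeta.Admissible (d : ℕ) (B : NobleBeta) : Prop :=
  1 ≤ B.βμ ∧ 0 ≤ B.βPi ∧ 0 ≤ B.βΨ ∧ 2 * d * B.βΨ / (2 * d - 1) < 1 ∧ B.βΔ < B.αFlow

/-- The right-hand side `max{β_μ̄, c_μ} (1 + β̄_Π)/(1 - (2d/(2d-1)) β_Ψ)` of the condition on `γ₁` in
Def. 2.9 (without its `f₁(z_I)` term). [cite: FitznerVanDerHofstad2016NoBLE, Def. 2.9 (condition on γ₁)] -/
def NobleBeta.f1Bound (d : ℕ) (B : NobleBeta) (cμ : ℝ) : ℝ :=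
  max B.βμ cμ * ((1 + B.βPi) / (1 - 2 * d * B.βΨ / (2 * d - 1)))

/-- The right-hand side `((2d-1)/(2d-2)) (β̄_c + β_α + β_{R,Φ})/(β_F - β_{ΔR_F})` of the condition on
`γ₂` in Def. 2.9. [cite: FitznerVanDerHofstad2016NoBLE, Def. 2.9 (condition on γ₂)] -/
def NobleBeta.f2Bound (d : ℕ) (B : NobleBeta) : ℝ :=
  (2 * d - 1) / (2 * d - 2) * ((B.cΦup + B.βαΦ + B.βRΦ) / (B.αFlow - B.βΔ))

/-- **The simplified NoBLE form of `τ̂_p` with the Lemma 3.1 data and the Assumption 2.7 bounds,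
at a parameter `p`, for constants `B`**: there are reals `c_Φ, α_Φ, c_F, α_F` and summable
`R_Φ, R_F : ℤ^d → ℝ` (the rewrite of `Φ̂_z`, `F̂_z` of §1.3, identified in §4.1) with
`τ̂_p(k)(1 - F̂(k)) = Φ̂(k)` on `[-π,π]^d`; reals `ψ = Ψ̂^κ_p(0)`, `π = Σ_κ Π̂^{ι,κ}_p(0)` and
`λ = λ_p` with `μ_p = (1+π)λ/(1+ψ(1+λ))` and `F̂(0) = 2dλ/(1+λ)` (Lemma 3.1), `0 ≤ λ`,
`(2d-1)λ < 1` (proof of Lemma 3.2: "`λ_z < (2d-1)⁻¹`"; `λ_z ≥ 0` is implicit there, the display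
multiplying `π ≤ β̄_Π` by `(2d-1)λ_z` and using `1 + λ_z ≤ 2d/(2d-1)`); and the bounds of
Assumption 2.7 (a) (`μ̄_p = p ≤ β_μ̄ μ_p`, `0 ≤ c_Φ ≤ β̄_c`, `|α_Φ| ≤ β_α`, `α_F ≥ β_F`), (b) (`π ≤ β̄_Π`,
`ψ ≥ -β_Ψ`) and (c) (`Σ|R_Φ| ≤ β_{R,Φ}`, `R̂_F(0) - R̂_F(k) ≥ -β_{ΔR_F}[1 - D̂(k)]`). For percolation
`μ̄_p = p` and `μ_p = nobleMu d p` (FvdH 2017, §2.4).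
[cite: FitznerVanDerHofstad2016NoBLE, §1.3 (simplified NoBLE form), Lemma 3.1, Lemma 3.2 (proof), Assumption 2.7 (a)–(c), §4.1]
[cite: FitznerVanDerHofstad2017, §2.4 (μ̄_p = p, μ_p) and §2.3 (NoBLE equation)] -/
def NobleSimplifiedFormAt (d : ℕ) (p : unitInterval) (B : NobleBeta) : Prop :=
  ∃ (cΦ αΦ cF αF ψ π lam : ℝ) (RΦ RF : Site d → ℝ), Summable RΦ ∧ Summable RF ∧
    (∀ k ∈ cube d, tauHat d p k * (1 - (cF + αF * Dhat d k + cosFT RF k)) =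
      cΦ + αΦ * Dhat d k + cosFT RΦ k) ∧
    nobleMu d p = (1 + π) * lam / (1 + ψ * (1 + lam)) ∧
    cF + αF + cosFT RF 0 = 2 * d * lam / (1 + lam) ∧ 0 ≤ lam ∧ (2 * d - 1) * lam < 1 ∧
    (p : ℝ) ≤ B.βμ * nobleMu d p ∧ 0 ≤ cΦ ∧ cΦ ≤ B.cΦup ∧ |αΦ| ≤ B.βαΦ ∧ B.αFlow ≤ αF ∧
    π ≤ B.βPi ∧ -B.βΨ ≤ ψ ∧
    ∑' x, |RΦ x| ≤ B.βRΦ ∧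
    (∀ k ∈ cube d, -(B.βΔ * (1 - Dhat d k)) ≤ cosFT RF 0 - cosFT RF k)

/-- Under the simplified form with admissible constants, `f₁(p) ≤ f1Bound` and `f₂(p) ≤ f2Bound`
(Lemmas 3.2 and 3.4 combined; `d ≥ 2`, `c_μ ≥ 0`).
[cite: FitznerVanDerHofstad2016NoBLE, Lemma 3.2 and Lemma 3.4] -/
theorem NobleSimplifiedFormAt.nobleF1_le_and_nobleF2_le (hd : 2 ≤ d) {p : unitInterval}
    {B : NobleBeta} (hB : B.Admissible d) {cμ : ℝ} (hcμ : 0 ≤ cμ)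
    (h : NobleSimplifiedFormAt d p B) :
    nobleF1 d cμ p ≤ B.f1Bound d cμ ∧ nobleF2 d p ≤ B.f2Bound d := by
  obtain ⟨cΦ, αΦ, cF, αF, ψ, π, lam, RΦ, RF, hRΦ, -, hform, hμ, hF0, hlam0, hlam1, hratio, hcΦ0,
    hcΦ, hαΦ, hαF, hπ, hψ, hRΦle, hRFb⟩ := h
  obtain ⟨hβμ, hβPi, hβΨ, hden, hgap⟩ := hB
  exact ⟨nobleF1_le_of_link (by omega) hμ hlam0 hlam1 hπ hψ hratio hcμ (by linarith) hβPi hβΨ hden,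
    nobleF2_le_of_simplifiedForm hd hRΦ hform hF0 hlam0 hlam1 hcΦ0 hcΦ hαΦ hRΦle hαF hRFb hgap⟩

/-- NAMED FACT — **the inputs of the NoBLE analysis for percolation in `d ≥ 11`**, i.e. what
parts (a), (b), (d) of the proof of Fitzner–van der Hofstad 2017, Thm. 1.1 (§2.1) together with
[FitHof13b] §4 and §3.3 deliver, in the form consumed by [FitHof13b] Lemmas 3.2 and 3.4: for every
`d ≥ 11` there are constants `c_μ > 1`, `c_{n,l,S} > 0` (§2.4, "some well-chosen constants"),
`γ_i < Γ_i` and admissible `β`'s (Assumption 2.7, "depending only on `Γ₁,Γ₂,Γ₃`, `d` and the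
model"; for percolation Assumption 5.7 of FvdH 2017, verified in its §5.4 from Props. 2.1–2.2, and
translated by [FitHof13b] Prop. 4.5) such that
(1) the conditions on `γ₁`, `γ₂` of Def. 2.9 hold: `γ₁ ≥ max{f₁(p_I), max{β_μ̄,c_μ}(1+β̄_Π)/(1-(2d/(2d-1))β_Ψ)}`,
`γ₂ ≥ ((2d-1)/(2d-2))(β̄_c+β_α+β_{R,Φ})/(β_F-β_{ΔR_F})` (verified by the notebooks — FvdH 2017 §2.5:
"The next three dots show that the improvement has been successful"; [FitHof13b] §6);
(2) the initialisation for `f₂`, `f₃`: `f₂(p_I) ≤ γ₂`, `f₃(p_I) ≤ γ₃` ([FitHof13b] Prop. 2.11: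
"`f_i(z_I) < γ_i`"; Lemma 3.4 at `z = z_I` and §3.3.3; FvdH 2017 §2.5: "The first 3 dots … are the
verifications that `f_i(1/(2d-1)) ≤ γ_i`");
(3) for every `p ∈ (p_I, p_c)` with `f_i(p) ≤ Γ_i` (`i = 1,2,3`): the simplified NoBLE form of `τ̂_p`
with the Lemma 3.1 data and the Assumption 2.7 bounds (`NobleSimplifiedFormAt d p β`; FvdH 2017
Prop. 2.1 and §2.3; [FitHof13b] §1.3, §4.1, Lemma 3.1, Assumption 2.7), and the `f₃`-improvement
`f₃(p) ≤ γ₃` ([FitHof13b] §3.3.5, "Final bound on `f₃`", with the condition on `γ₃` of Def. 2.9; §5).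
The range `d ≥ 11` is that of FvdH 2017 Prop. 2.4 (monotonicity in `d`: ASSERTED in [FitHof13b]
§2.5 p. 1062 and §6 p. 1104, which refer for it to the percolation paper FvdH 2017 — where no such
passage exists, EJP 22 (2017) no. 43 pp. 1–65 — and to the lattice-tree/animal sequel
Fitzner–van der Hofstad, J. Stat. Phys. 185 (2021) no. 13, whose §9 proves it for lattice animals
only; FvdH 2017 Thm. 1.2 tabulates separate verifications at `d = 11, …, 15, 20`). NOT
formalised: behind it stand the NoBLE coefficients (FvdH 2017 §3), Props. 2.1–2.2, the
`f₃`-analysis and 112 rigorous simple-random-walk integrals. Users take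
`(h : FitznerVanDerHofstad2017_nobleAnalysisInputs)`; it implies `FitznerVanDerHofstad2017_prop24`
(`FitznerVanDerHofstad2017_prop24_of_nobleAnalysisInputs`).
[cite: FitznerVanDerHofstad2017, Prop. 2.4, Prop. 2.1, Prop. 2.2, §2.3, §2.4 (claims (ii)–(iii)), §2.5, Assumption 5.7 and §5.4]
[cite: FitznerVanDerHofstad2016NoBLE, Def. 2.9, Prop. 2.11, Assumption 2.7, Lemma 3.1, §1.3, §3.3.3, §3.3.5, Prop. 4.5, §6] -/
def FitznerVanDerHofstad2017_nobleAnalysisInputs : Prop :=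
  ∀ d : ℕ, 11 ≤ d → ∃ (cμ : ℝ) (c : Fin 6 → ℝ) (γ Γ : Fin 3 → ℝ) (B : NobleBeta),
    1 < cμ ∧ (∀ i, 0 < c i) ∧ (∀ i, γ i < Γ i) ∧ B.Admissible d ∧
    max (nobleF1 d cμ (nbwThresholdI d)) (B.f1Bound d cμ) ≤ γ 0 ∧ B.f2Bound d ≤ γ 1 ∧
    nobleF2 d (nbwThresholdI d) ≤ γ 1 ∧ nobleF3 d c (nbwThresholdI d) ≤ γ 2 ∧
    ∀ p : unitInterval, p ∈ Set.Ioo (nbwThresholdI d) (criticalProbI d) →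
      (∀ i, nobleF d cμ c i p ≤ Γ i) → NobleSimplifiedFormAt d p B ∧ nobleF3 d c p ≤ γ 2

/-- **Prop. 2.4 (with its initialisation) from the inputs of the NoBLE analysis** — [FitHof13b]'s
"We prove Proposition 2.11 … one function `f_i` at a time" (§3) for percolation: the initialisation
is the condition `γ₁ ≥ f₁(p_I)` of Def. 2.9 and input (2); the improvement on `(p_I, p_c)` is
Lemma 3.2 for `f₁`, Lemma 3.4 for `f₂` (both proved above from the simplified form) and input (3)
for `f₃`. [cite: FitznerVanDerHofstad2016NoBLE, Prop. 2.11 (proof in §3: Lemmas 3.2, 3.4, §3.3.5)]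
[cite: FitznerVanDerHofstad2017, Prop. 2.4 and §2.4 (claims (ii)–(iii))] -/
theorem FitznerVanDerHofstad2017_prop24_of_nobleAnalysisInputs
    (h : FitznerVanDerHofstad2017_nobleAnalysisInputs) : FitznerVanDerHofstad2017_prop24 := by
  intro d hd
  obtain ⟨cμ, c, γ, Γ, B, hcμ, hc, hγΓ, hB, hP1, hP2, hI2, hI3, hstep⟩ := h d hd
  refine ⟨cμ, c, γ, Γ, hcμ, hc, hγΓ, ?_, ?_⟩
  · intro i
    fin_cases i
    · exact (le_max_left _ _).trans hP1
    · exact hI2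
    · exact hI3
  · intro p hp hΓ i
    obtain ⟨hform, hf3⟩ := hstep p hp hΓ
    have h12 := hform.nobleF1_le_and_nobleF2_le (by omega) hB (zero_le_one.trans hcμ.le)
    fin_cases i
    · exact (h12.1.trans (le_max_right _ _)).trans hP1
    · exact h12.2.trans hP2
    · exact hf3

/-- Hence `FitznerVanDerHofstad2017_nobleBound` (and the `d ≥ 11` infrared bound) from the inputs of
the NoBLE analysis and the continuity of the weighted diagrams ([FitHof13b] Lemma 3.5).
[cite: FitznerVanDerHofstad2016NoBLE, Thm. 2.10 and Prop. 2.11] [cite: FitznerVanDerHofstad2017, Thm. 1.1 and Prop. 2.4] -/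
theorem FitznerVanDerHofstad2017_nobleBound_of_nobleAnalysisInputs
    (h35 : FitznerVanDerHofstad2016NoBLE_lemma35) (h : FitznerVanDerHofstad2017_nobleAnalysisInputs) :
    FitznerVanDerHofstad2017_nobleBound :=
  FitznerVanDerHofstad2017_nobleBound_of_prop24 h35 (FitznerVanDerHofstad2017_prop24_of_nobleAnalysisInputs h)

end Literature.Barriers.CriticalPhenomena

end
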